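import Summits.Ventures.LatticeQCDFlow.Scaling.ResolventLaw
import Summits.Ventures.LatticeQCDFlow.Scaling.CycleEndHubGainConcave

/-!
HONEST FRAMING: exact (Metropolis-corrected) sampling algorithms for lattice gauge theory; figures
of merit are autocorrelation/cost numbers at stated couplings and volumes; no continuum-physics
claim.

# ResolventPairCoupling — A MARKOVIAN COUPLING OF TWO HUB CHAINS, STOPPED AT THE COMMON GEOMETRIC TIME, COUPLES THE TWO END-HUB LAWS; HENCE THE CYCLE-END GAIN `G(u_X,u_Y)`
# IS BOUNDED BELOW BY ANY SUB-SOLUTION OF THE PAIR RESOLVENT INEQUALITY FOR THE TERMINAL GAIN `g(a,b) = 𝟙{a∈A} − 𝟙{b∈A} − 𝟙{b∈C, b≠a}` (lean-2 GEN-36, ours)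

Venture-side (OURS).  Cell `lqcd-flow` (pub-lqcd), unit `pub-lqcd-lean-2-g36`, 2026-08-29.  Chapter W (item 1 (i) at finite swap odds), file 3.  Two copies of the star with
compositions `N_X`, `N_Y` and a common hub `z` run their swap phases with one-copy hub chains `K_X`, `K_Y` (different matrices: the levels differ) for the SAME geometric
number of attempts.  Any pair kernel `K_p` on `S × S` whose marginals are `K_X`, `K_Y` row by row (a Markovian coupling of two different chains; hypothesis-equations
`hmX`, `hmY`) defines the pair resolvent `u_p = (1−σ)ν_p + σ·u_pK_p` (`Scaling/ResolventLaw` on the product type); its two marginals solve the one-copy resolvent equations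
(`pairResolvent_marginal_fst/snd`), so by uniqueness they ARE the end-hub laws `u_X`, `u_Y` and `u_p` is a coupling of them (`pairResolvent_isCoupling`).  Consequently
(chapter V file 4's concavity at point masses) the cycle-end gain of `Scaling/CycleEndHubBracket` satisfies `G(u_X,u_Y) ≥ Σ_{a,b} u_p(a,b)·g(a,b)` with the terminal gain
`g(a,b) = 𝟙{a∈A} − 𝟙{b∈A} − 𝟙{b∈C, b≠a}` (`hubGain_ge_pairResolvent`), and the sub-solution principle turns this into **`G(u_X,u_Y) ≥ Σ ν_p V` for every `V` with
`V ≤ (1−σ)g + σ·K_pV`** (`hubGain_ge_of_pairSubsolution`; from a common hub, `ν_p = δ_(z,z)`, this is `G ≥ V(z,z)`).  Linear one-copy functionals (the deleted masses `R_X`,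
`R_Y` of chapter V file 5) are pair expectations too (`pairResolvent_expect_fst/snd`), so the whole equal-hub criterion of `Scaling/LumpedCycleAnyCoupling` for the coupling
`q_{xy} = u_p` is ONE linear functional of `u_p`, bounded by ONE super-solution on `S × S` (`pairResolvent_functional_le_of_supersolution`).  Hypothesis-equations, no definitions.

## What is proved

* §1 `pairKernel_rowsum`, **`pairResolvent_marginal_fst`**, **`pairResolvent_marginal_snd`**, `pairResolvent_fst_eq`, `pairResolvent_snd_eq`, **`pairResolvent_isCoupling`**,
  `pairResolvent_expect_fst`, `pairResolvent_expect_snd`.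
* §2 **`hubGain_ge_pairResolvent`**, **`hubGain_ge_of_pairSubsolution`**, `pairResolvent_functional_le_of_supersolution`, `pairResolvent_functional_ge_of_subsolution`.

Reading (no numerics implied): the tool MEMO-gen35 §7 asks for («prove the criterion for the resolvent by induction on attempts with a potential-style invariant») in closed
form: the invariant is the sub- or super-solution `V` on hub PAIRS, the induction is `Scaling/ResolventLaw`.  NOT CLAIMED: any particular `V`.  Literature grade (cell rule): OWN,
elementary; nothing cited as a fact; no new bib keys.
-/

open Finset
open Literature.Probability.MarkovChains

namespace Summit.Ventures.LatticeQCDFlow.Scaling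

section PairResolvent
variable {S : Type*} [Fintype S] [DecidableEq S]
variable {KX KY : S → S → ℝ} {Kp : S × S → S × S → ℝ} {σ : ℝ} {νX νY uX uY : S → ℝ} {νp up : S × S → ℝ}

/-! ## §1 Marginals of the pair resolvent -/

omit [DecidableEq S] in
/-- The rows of a pair kernel with stochastic first marginal sum to one. [ours] -/
theorem pairKernel_rowsum (hKX1 : ∀ a, ∑ a', KX a a' = 1) (hmX : ∀ a b a', ∑ b', Kp (a, b) (a', b') = KX a a') (s : S × S) :
    ∑ s', Kp s s' = 1 := by
  obtain ⟨a, b⟩ := s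
  rw [Fintype.sum_prod_type]
  simp_rw [hmX a b]
  exact hKX1 a

omit [DecidableEq S] in
/-- **The first marginal of the pair resolvent solves the first resolvent equation:** with `m a = Σ_b u_p(a,b)` and `ν_X a = Σ_b ν_p(a,b)`,
`m = (1−σ)ν_X + σ·mK_X`. [ours] -/
theorem pairResolvent_marginal_fst (hmX : ∀ a b a', ∑ b', Kp (a, b) (a', b') = KX a a')
    (hνX : ∀ a, ∑ b, νp (a, b) = νX a) (hup : ∀ s, up s = (1 - σ) * νp s + σ * ∑ r, up r * Kp r s)
    {m : S → ℝ} (hm : ∀ a, m a = ∑ b, up (a, b)) (a : S) :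
    m a = (1 - σ) * νX a + σ * ∑ h, m h * KX h a := by
  rw [hm a]
  calc ∑ b, up (a, b) = ∑ b, ((1 - σ) * νp (a, b) + σ * ∑ r, up r * Kp r (a, b)) := sum_congr rfl fun b _ => hup (a, b)
    _ = (1 - σ) * ∑ b, νp (a, b) + σ * ∑ b, ∑ r, up r * Kp r (a, b) := by rw [sum_add_distrib, ← mul_sum, ← mul_sum]
    _ = (1 - σ) * νX a + σ * ∑ r, up r * ∑ b, Kp r (a, b) := by
        rw [hνX a, Finset.sum_comm]; congr 1; congr 1
        exact sum_congr rfl fun r _ => by rw [mul_sum]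
    _ = (1 - σ) * νX a + σ * ∑ h, m h * KX h a := by
        congr 1; congr 1
        rw [Fintype.sum_prod_type]
        refine sum_congr rfl fun h _ => ?_
        rw [hm h, sum_mul]
        exact sum_congr rfl fun k _ => by rw [hmX h k a]

omit [DecidableEq S] in
/-- **The second marginal of the pair resolvent solves the second resolvent equation.** [ours] -/
theorem pairResolvent_marginal_snd (hmY : ∀ a b b', ∑ a', Kp (a, b) (a', b') = KY b b')
    (hνY : ∀ b, ∑ a, νp (a, b) = νY b) (hup : ∀ s, up s = (1 - σ) * νp s + σ * ∑ r, up r * Kp r s)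
    {m : S → ℝ} (hm : ∀ b, m b = ∑ a, up (a, b)) (b : S) :
    m b = (1 - σ) * νY b + σ * ∑ h, m h * KY h b := by
  rw [hm b]
  calc ∑ a, up (a, b) = ∑ a, ((1 - σ) * νp (a, b) + σ * ∑ r, up r * Kp r (a, b)) := sum_congr rfl fun a _ => hup (a, b)
    _ = (1 - σ) * ∑ a, νp (a, b) + σ * ∑ a, ∑ r, up r * Kp r (a, b) := by rw [sum_add_distrib, ← mul_sum, ← mul_sum]
    _ = (1 - σ) * νY b + σ * ∑ r, up r * ∑ a, Kp r (a, b) := by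
        rw [hνY b, Finset.sum_comm]; congr 1; congr 1
        exact sum_congr rfl fun r _ => by rw [mul_sum]
    _ = (1 - σ) * νY b + σ * ∑ h, m h * KY h b := by
        congr 1; congr 1
        rw [Fintype.sum_prod_type, Finset.sum_comm]
        refine sum_congr rfl fun k _ => ?_
        rw [hm k, sum_mul]
        exact sum_congr rfl fun h _ => by rw [hmY h k b]

omit [DecidableEq S] in
/-- Non-negativity of a pair kernel with non-negative entries gives stochastic rows (bundled for `Scaling/ResolventLaw`). [ours] -/
theorem pairResolvent_nonneg (hKX1 : ∀ a, ∑ a', KX a a' = 1) (hmX : ∀ a b a', ∑ b', Kp (a, b) (a', b') = KX a a') (hKp0 : ∀ s s', 0 ≤ Kp s s')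
    (hσ0 : 0 ≤ σ) (hσ1 : σ < 1) (hνp0 : ∀ s, 0 ≤ νp s) (hup : ∀ s, up s = (1 - σ) * νp s + σ * ∑ r, up r * Kp r s) (s : S × S) : 0 ≤ up s :=
  geomResolvent_nonneg hKp0 (pairKernel_rowsum hKX1 hmX) hσ0 hσ1 hνp0 hup s

omit [DecidableEq S] in
/-- **The first marginal IS the first end-hub law** (uniqueness of the one-copy resolvent). [ours] -/
theorem pairResolvent_fst_eq (hKX0 : ∀ a a', 0 ≤ KX a a') (hKX1 : ∀ a, ∑ a', KX a a' = 1) (hmX : ∀ a b a', ∑ b', Kp (a, b) (a', b') = KX a a')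
    (hσ0 : 0 ≤ σ) (hσ1 : σ < 1) (hνX : ∀ a, ∑ b, νp (a, b) = νX a)
    (hup : ∀ s, up s = (1 - σ) * νp s + σ * ∑ r, up r * Kp r s) (huX : ∀ a, uX a = (1 - σ) * νX a + σ * ∑ h, uX h * KX h a) (a : S) :
    ∑ b, up (a, b) = uX a := by
  have h := geomResolvent_unique (ν := νX) (u := fun a => ∑ b, up (a, b)) (u' := uX) hKX0 hKX1 hσ0 hσ1
    (pairResolvent_marginal_fst hmX hνX hup (m := fun a => ∑ b, up (a, b)) (fun _ => rfl)) huX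
  exact congrFun h a

omit [DecidableEq S] in
/-- **The second marginal IS the second end-hub law.** [ours] -/
theorem pairResolvent_snd_eq (hKY0 : ∀ b b', 0 ≤ KY b b') (hKY1 : ∀ b, ∑ b', KY b b' = 1) (hmY : ∀ a b b', ∑ a', Kp (a, b) (a', b') = KY b b')
    (hσ0 : 0 ≤ σ) (hσ1 : σ < 1) (hνY : ∀ b, ∑ a, νp (a, b) = νY b)
    (hup : ∀ s, up s = (1 - σ) * νp s + σ * ∑ r, up r * Kp r s) (huY : ∀ b, uY b = (1 - σ) * νY b + σ * ∑ h, uY h * KY h b) (b : S) :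
    ∑ a, up (a, b) = uY b := by
  have h := geomResolvent_unique (ν := νY) (u := fun b => ∑ a, up (a, b)) (u' := uY) hKY0 hKY1 hσ0 hσ1
    (pairResolvent_marginal_snd hmY hνY hup (m := fun b => ∑ a, up (a, b)) (fun _ => rfl)) huY
  exact congrFun h b

omit [DecidableEq S] in
/-- **THE PAIR RESOLVENT COUPLES THE TWO END-HUB LAWS.** [ours] -/
theorem pairResolvent_isCoupling (hKX0 : ∀ a a', 0 ≤ KX a a') (hKX1 : ∀ a, ∑ a', KX a a' = 1) (hKY0 : ∀ b b', 0 ≤ KY b b') (hKY1 : ∀ b, ∑ b', KY b b' = 1)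
    (hmX : ∀ a b a', ∑ b', Kp (a, b) (a', b') = KX a a') (hmY : ∀ a b b', ∑ a', Kp (a, b) (a', b') = KY b b') (hKp0 : ∀ s s', 0 ≤ Kp s s')
    (hσ0 : 0 ≤ σ) (hσ1 : σ < 1) (hνp0 : ∀ s, 0 ≤ νp s) (hνX : ∀ a, ∑ b, νp (a, b) = νX a) (hνY : ∀ b, ∑ a, νp (a, b) = νY b)
    (hup : ∀ s, up s = (1 - σ) * νp s + σ * ∑ r, up r * Kp r s)
    (huX : ∀ a, uX a = (1 - σ) * νX a + σ * ∑ h, uX h * KX h a) (huY : ∀ b, uY b = (1 - σ) * νY b + σ * ∑ h, uY h * KY h b) :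
    IsCoupling uX uY (fun a b => up (a, b)) :=
  ⟨fun a b => pairResolvent_nonneg hKX1 hmX hKp0 hσ0 hσ1 hνp0 hup (a, b),
    fun a => pairResolvent_fst_eq hKX0 hKX1 hmX hσ0 hσ1 hνX hup huX a,
    fun b => pairResolvent_snd_eq hKY0 hKY1 hmY hσ0 hσ1 hνY hup huY b⟩

omit [DecidableEq S] in
/-- One-copy linear functionals are pair expectations (first copy). [ours] -/
theorem pairResolvent_expect_fst {q : S → S → ℝ} (hq : IsCoupling uX uY q) (f : S → ℝ) :
    ∑ a, uX a * f a = ∑ a, ∑ b, q a b * f a := by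
  refine sum_congr rfl fun a _ => ?_
  rw [← hq.2.1 a, sum_mul]

omit [DecidableEq S] in
/-- One-copy linear functionals are pair expectations (second copy). [ours] -/
theorem pairResolvent_expect_snd {q : S → S → ℝ} (hq : IsCoupling uX uY q) (f : S → ℝ) :
    ∑ b, uY b * f b = ∑ a, ∑ b, q a b * f b := by
  rw [Finset.sum_comm]
  refine sum_congr rfl fun b _ => ?_
  rw [← hq.2.2 b, sum_mul]

/-! ## §2 The gain is bounded below by sub-solutions of the pair resolvent inequality -/

/-- **ANY COUPLING OF THE END-HUB LAWS BOUNDS THE GAIN BELOW BY ITS EXPECTED TERMINAL GAIN:** for a coupling `q` of `(u_X,u_Y)`,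
`Σ_{a,b} q(a,b)·(𝟙{a∈A} − 𝟙{b∈A} − 𝟙{b∈C, b≠a}) ≤ G(u_X,u_Y) = u_X(A) − u_Y(A) − Σ_C (u_Y − u_X)⁺`. [ours] -/
theorem hubGain_ge_coupling (NX NY : S → ℕ) {q : S → S → ℝ} (hq : IsCoupling uX uY q) :
    ∑ a, ∑ b, q a b * ((if NY a < NX a then (1 : ℝ) else 0) - (if NY b < NX b then (1 : ℝ) else 0) - (if NX b = NY b ∧ b ≠ a then (1 : ℝ) else 0))
      ≤ ∑ w, uX w * (if NY w < NX w then (1 : ℝ) else 0) - ∑ w, uY w * (if NY w < NX w then (1 : ℝ) else 0)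
        - ∑ w, max (uY w - uX w) 0 * (if NX w = NY w then (1 : ℝ) else 0) := by
  -- concavity (chapter V file 4) at the point masses `U a = δ_a`, `U' b = δ_b` with weights `q`
  have hu : ∀ w, uX w = ∑ a, ∑ b, q a b * (if w = a then (1 : ℝ) else 0) := by
    intro w
    have : ∀ a, ∑ b, q a b * (if w = a then (1 : ℝ) else 0) = (if w = a then (1 : ℝ) else 0) * uX a := fun a => by
      rw [← sum_mul, hq.2.1 a, mul_comm]
    simp_rw [this]
    simp
  have hu' : ∀ w, uY w = ∑ a, ∑ b, q a b * (if w = b then (1 : ℝ) else 0) := by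
    intro w
    rw [Finset.sum_comm]
    have : ∀ b, ∑ a, q a b * (if w = b then (1 : ℝ) else 0) = (if w = b then (1 : ℝ) else 0) * uY b := fun b => by
      rw [← sum_mul, hq.2.2 b, mul_comm]
    simp_rw [this]
    simp
  have h := hubGain_concave NX NY q hq.1 (fun a w => if w = a then (1 : ℝ) else 0) (fun b w => if w = b then (1 : ℝ) else 0) uX uY hu hu'
  refine le_trans (le_of_eq ?_) h
  refine sum_congr rfl fun a _ => sum_congr rfl fun b _ => ?_
  rw [hubGain_dirac NX NY a b]

/-- **The pair resolvent version:** `Σ u_p·g ≤ G(u_X,u_Y)` for the pair resolvent of a Markovian coupling of the two hub chains. [ours] -/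
theorem hubGain_ge_pairResolvent (NX NY : S → ℕ) (hKX0 : ∀ a a', 0 ≤ KX a a') (hKX1 : ∀ a, ∑ a', KX a a' = 1) (hKY0 : ∀ b b', 0 ≤ KY b b')
    (hKY1 : ∀ b, ∑ b', KY b b' = 1) (hmX : ∀ a b a', ∑ b', Kp (a, b) (a', b') = KX a a') (hmY : ∀ a b b', ∑ a', Kp (a, b) (a', b') = KY b b')
    (hKp0 : ∀ s s', 0 ≤ Kp s s') (hσ0 : 0 ≤ σ) (hσ1 : σ < 1) (hνp0 : ∀ s, 0 ≤ νp s) (hνX : ∀ a, ∑ b, νp (a, b) = νX a) (hνY : ∀ b, ∑ a, νp (a, b) = νY b)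
    (hup : ∀ s, up s = (1 - σ) * νp s + σ * ∑ r, up r * Kp r s)
    (huX : ∀ a, uX a = (1 - σ) * νX a + σ * ∑ h, uX h * KX h a) (huY : ∀ b, uY b = (1 - σ) * νY b + σ * ∑ h, uY h * KY h b) :
    ∑ a, ∑ b, up (a, b) * ((if NY a < NX a then (1 : ℝ) else 0) - (if NY b < NX b then (1 : ℝ) else 0) - (if NX b = NY b ∧ b ≠ a then (1 : ℝ) else 0))
      ≤ ∑ w, uX w * (if NY w < NX w then (1 : ℝ) else 0) - ∑ w, uY w * (if NY w < NX w then (1 : ℝ) else 0)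
        - ∑ w, max (uY w - uX w) 0 * (if NX w = NY w then (1 : ℝ) else 0) :=
  hubGain_ge_coupling NX NY (pairResolvent_isCoupling hKX0 hKX1 hKY0 hKY1 hmX hmY hKp0 hσ0 hσ1 hνp0 hνX hνY hup huX huY)

/-- **SUB-SOLUTIONS OF THE PAIR RESOLVENT INEQUALITY BOUND THE GAIN:** if `V(a,b) ≤ (1−σ)·g(a,b) + σ·Σ_{s'} K_p((a,b),s')V(s')` for all pairs, then
`Σ_s ν_p(s)V(s) ≤ G(u_X,u_Y)`; from a common hub (`ν_p = δ_(z,z)`) this reads `V(z,z) ≤ G`. [ours] -/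
theorem hubGain_ge_of_pairSubsolution (NX NY : S → ℕ) (hKX0 : ∀ a a', 0 ≤ KX a a') (hKX1 : ∀ a, ∑ a', KX a a' = 1) (hKY0 : ∀ b b', 0 ≤ KY b b')
    (hKY1 : ∀ b, ∑ b', KY b b' = 1) (hmX : ∀ a b a', ∑ b', Kp (a, b) (a', b') = KX a a') (hmY : ∀ a b b', ∑ a', Kp (a, b) (a', b') = KY b b')
    (hKp0 : ∀ s s', 0 ≤ Kp s s') (hσ0 : 0 ≤ σ) (hσ1 : σ < 1) (hνp0 : ∀ s, 0 ≤ νp s) (hνX : ∀ a, ∑ b, νp (a, b) = νX a) (hνY : ∀ b, ∑ a, νp (a, b) = νY b)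
    (hup : ∀ s, up s = (1 - σ) * νp s + σ * ∑ r, up r * Kp r s)
    (huX : ∀ a, uX a = (1 - σ) * νX a + σ * ∑ h, uX h * KX h a) (huY : ∀ b, uY b = (1 - σ) * νY b + σ * ∑ h, uY h * KY h b)
    {V : S × S → ℝ}
    (hV : ∀ s : S × S, V s ≤ (1 - σ) * ((if NY s.1 < NX s.1 then (1 : ℝ) else 0) - (if NY s.2 < NX s.2 then (1 : ℝ) else 0)
        - (if NX s.2 = NY s.2 ∧ s.2 ≠ s.1 then (1 : ℝ) else 0)) + σ * ∑ s', Kp s s' * V s') :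
    ∑ s, νp s * V s ≤ ∑ w, uX w * (if NY w < NX w then (1 : ℝ) else 0) - ∑ w, uY w * (if NY w < NX w then (1 : ℝ) else 0)
        - ∑ w, max (uY w - uX w) 0 * (if NX w = NY w then (1 : ℝ) else 0) := by
  have h1 := geomResolvent_expect_ge_of_subsolution (K := Kp) (ν := νp) (u := up)
    (f := fun s : S × S => (if NY s.1 < NX s.1 then (1 : ℝ) else 0) - (if NY s.2 < NX s.2 then (1 : ℝ) else 0)
        - (if NX s.2 = NY s.2 ∧ s.2 ≠ s.1 then (1 : ℝ) else 0)) hσ1 hup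
    (pairResolvent_nonneg hKX1 hmX hKp0 hσ0 hσ1 hνp0 hup) hV
  have h2 := hubGain_ge_pairResolvent NX NY hKX0 hKX1 hKY0 hKY1 hmX hmY hKp0 hσ0 hσ1 hνp0 hνX hνY hup huX huY
  refine le_trans ?_ h2
  simpa only [Fintype.sum_prod_type] using h1

omit [DecidableEq S] in
/-- **One super-solution bounds any pair functional of the end hubs from above:** if `(1−σ)φ + σ·K_pV ≤ V` pointwise then `Σ u_p φ ≤ Σ ν_p V`
(the form in which the equal-hub criterion of `Scaling/LumpedCycleAnyCoupling` with `q_{xy} = u_p` is certified). [ours] -/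
theorem pairResolvent_functional_le_of_supersolution (hKX1 : ∀ a, ∑ a', KX a a' = 1) (hmX : ∀ a b a', ∑ b', Kp (a, b) (a', b') = KX a a')
    (hKp0 : ∀ s s', 0 ≤ Kp s s') (hσ0 : 0 ≤ σ) (hσ1 : σ < 1) (hνp0 : ∀ s, 0 ≤ νp s)
    (hup : ∀ s, up s = (1 - σ) * νp s + σ * ∑ r, up r * Kp r s) {φ V : S × S → ℝ}
    (hV : ∀ s, (1 - σ) * φ s + σ * ∑ s', Kp s s' * V s' ≤ V s) : ∑ s, up s * φ s ≤ ∑ s, νp s * V s :=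
  geomResolvent_expect_le_of_supersolution hσ1 hup (pairResolvent_nonneg hKX1 hmX hKp0 hσ0 hσ1 hνp0 hup) hV

omit [DecidableEq S] in
/-- **and any sub-solution bounds it from below.** [ours] -/
theorem pairResolvent_functional_ge_of_subsolution (hKX1 : ∀ a, ∑ a', KX a a' = 1) (hmX : ∀ a b a', ∑ b', Kp (a, b) (a', b') = KX a a')
    (hKp0 : ∀ s s', 0 ≤ Kp s s') (hσ0 : 0 ≤ σ) (hσ1 : σ < 1) (hνp0 : ∀ s, 0 ≤ νp s)
    (hup : ∀ s, up s = (1 - σ) * νp s + σ * ∑ r, up r * Kp r s) {φ V : S × S → ℝ}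
    (hV : ∀ s, V s ≤ (1 - σ) * φ s + σ * ∑ s', Kp s s' * V s') : ∑ s, νp s * V s ≤ ∑ s, up s * φ s :=
  geomResolvent_expect_ge_of_subsolution hσ1 hup (pairResolvent_nonneg hKX1 hmX hKp0 hσ0 hσ1 hνp0 hup) hV

end PairResolvent

end Summit.Ventures.LatticeQCDFlow.Scaling
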